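import Summits.RiemannHypothesis.RiemannHypothesis.Theorems.PfPersistenceHeightLocality
import Summits.RiemannHypothesis.RiemannHypothesis.Theorems.PfPersistenceSectorLocality
import Summits.RiemannHypothesis.RiemannHypothesis.Theorems.PfPersistenceLookAhead
import Summits.RiemannHypothesis.RiemannHypothesis.Theorems.PfPersistencePolarRankOne
import HarnessLib

/-!
# PF persistence — JOINT READERS AT DEPTH `D`, the band-2 / sign-blind / pole-carrying vocabularies (pub-rhpf, barrier-typer gen 4)

**HONEST FRAMING. This is a long-odds MECHANISM SEARCH; no RH claims.** RH-free bookkeeping over the cell's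
records; every `Prop` below is a STATEMENT SHAPE (label TYPED) unless a theorem about it is marked PROVED. Nothing
here bears on the truth of RH.

* §1 RULING A74 — `JointReaderAt Φ win D d₀ S` (TYPED): the class `S` of multi-sector records cannot tell apart,
  from `d₀` (= `ζ`'s record), any record whose published FIELDS `Φ` at the window `win` (the `u₁^±` Galerkin
  coordinates, the `θ`-edge value, the eigenvalue ladders of both parities — kept ABSTRACT as any function of the
  window's matrices) agree with `d₀`'s to RELATIVE tolerance `10^{-D}` (`τ_rel`; `jointBallAt`). So F6-G3's
  "reader finer than `D*(a, N)`" is the Lean predicate `¬ JointReaderAt Φ win D* ζ S`, and "depth-`D` reader" is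
  `JointReaderAt Φ win D ζ S`. PROVED: monotone in `D`; a same-window twin at depth `D` (`JointTwinAt`, the F6 twins
  — DATA) closes every depth-`D` reader (`not_sectorSeparates_of_jointTwinAt`); and EVERY joint reader at ONE window,
  at EVERY depth, is closed-global by the far prime dial (wall W1, `not_sectorSeparates_of_jointReaderAt`; even-only
  form `not_separates_of_evenJointReaderAt` on `arithDialSpace`). The F6-G3 ceiling ("no arithmetic same-window twin
  beyond `D*`") is the negation shape `¬ JointTwinAt …` restricted to the first-order box — a MODEL statement (A67),
  not typed as a theorem here.
* §2 RULING A73 (F) band 2 — `InWindowSectorDialMatchingAt` (TYPED, multi-sector word of the in-window matching of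
  `PfPersistenceInWindowMirror`) and the band-2 TARGET `BandTwoAt` for the pair reader `(|ε₁^{ev}|, ε₁^{odd})` at one
  window (TYPED ONLY: its derivations — Newton–Kantorovich with the served datum `h ≤ ½`, or Poincaré–Miranda face
  signs — are BINDERS of the informal argument, never asserted); PROVED: such a matching closes every class factoring
  through the reader (`SectorFactorsThrough.not_sectorSeparates_of_inWindow`).
* §3 carver R12 (a) — the SIGN-BLIND LADDER READER `S_SB` of record (cand-8 K2-SB) as a `SectorWindowReader`
  (TYPED over an abstract ladder functional; it reads BOTH parities, so the even-only `WindowReader` cannot host it),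
  its look-ahead class `sectorLookAheadClassAt k` (= `𝒞_look(k)` on multi-sector records) and PROVED: finitely
  determined ⇒ closed-global above grid by W1 (`not_sectorSeparates_sectorLookAheadClassAt`).
* §4 lead R10 — POLE-CARRYING records: `polarDatumOf β w = −(arch + primes_w) + β • c cᵀ` (TYPED), PROVED
  `datumOf w = polarDatumOf 2 w` (every dial-space / arithmetic record carries the pole with `β = 2`), the dh-type
  controls are the DEGENERATE members `β = 0` (`poleFreeDatumOf`): typing G1.08 / G1.21c "on objects with a pole"
  does not change the tally domain `arithDialSpace` (pole-carrying by theorem); it only re-labels the `β = 0` controls.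
-/

set_option linter.dupNamespace false  -- the mandated namespace repeats `RiemannHypothesis`

noncomputable section

open Real Finset Matrix Set

namespace Summit.RiemannHypothesis.RiemannHypothesis.Theorems.PfPersistence

/-! ## §1 Joint readers at depth `D` (RULING A74) -/

/-- PUBLISHED FIELDS at a window: `m` real numbers read off ALL sector matrices of a record at `win` (e.g. the
Galerkin coordinates of `u₁^±`, the `θ`-edge value, the eigenvalue ladders of both parities — F6-G3's joint
magnitude fields); kept abstract: ANY function of the window's matrices. [folklore] -/
abbrev WindowFields (ι : Type) (m : ℕ) : Type :=
  (win : Window) → (ι → Matrix (Fin (win.N + 1)) (Fin (win.N + 1)) ℝ) → Fin m → ℝ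

/-- the `τ_rel` BALL OF DEPTH `D` at `win` around the record `d₀`: records whose every published field at `win` is
within RELATIVE tolerance `10^{-D}` of `d₀`'s (`|Φᵢ(d) − Φᵢ(d₀)| ≤ 10^{-D} |Φᵢ(d₀)|`). [folklore] -/
def jointBallAt {ι : Type} {m : ℕ} (Φ : WindowFields ι m) (win : Window) (D : ℝ) (d₀ : SectorDatum ι) :
    Set (SectorDatum ι) :=
  {d | ∀ i, |Φ win (d win) i - Φ win (d₀ win) i| ≤ (10 : ℝ) ^ (-D) * |Φ win (d₀ win) i|}

/-- **TYPED — JOINT READER AT `win` TO DEPTH `D` (RULING A74):** the class `S` factors through the fields `Φ` at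
`win` WITH TOLERANCE `10^{-D}` around `d₀`: it classifies every record of the depth-`D` ball like `d₀` itself.
"`S` is finer than `D*`" is `¬ JointReaderAt Φ win D* d₀ S`. (A `Prop` about a class; statement shape.) [folklore] -/
def JointReaderAt {ι : Type} {m : ℕ} (Φ : WindowFields ι m) (win : Window) (D : ℝ) (d₀ : SectorDatum ι)
    (S : Set (SectorDatum ι)) : Prop :=
  ∀ d ∈ jointBallAt Φ win D d₀, d ∈ S ↔ d₀ ∈ S

/-- PROVED: the anchor is in its own ball. [folklore] -/
theorem self_mem_jointBallAt {ι : Type} {m : ℕ} (Φ : WindowFields ι m) (win : Window) (D : ℝ)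
    (d₀ : SectorDatum ι) : d₀ ∈ jointBallAt Φ win D d₀ := fun i => by
  simp only [sub_self, abs_zero]; positivity

/-- PROVED: a record EQUAL to `d₀` at `win` (all sectors) is in every ball at `win` — whatever the fields. [folklore] -/
theorem mem_jointBallAt_of_eq {ι : Type} {m : ℕ} (Φ : WindowFields ι m) {win : Window} (D : ℝ)
    {d₀ d : SectorDatum ι} (h : d win = d₀ win) : d ∈ jointBallAt Φ win D d₀ := fun i => by
  rw [h, sub_self, abs_zero]; positivity

/-- PROVED: deeper balls are smaller, `D ≤ D' ⇒ ball(D') ⊆ ball(D)`. [folklore] -/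
theorem jointBallAt_anti {ι : Type} {m : ℕ} (Φ : WindowFields ι m) (win : Window) {D D' : ℝ} (h : D ≤ D')
    (d₀ : SectorDatum ι) : jointBallAt Φ win D' d₀ ⊆ jointBallAt Φ win D d₀ := fun d hd i =>
  (hd i).trans (mul_le_mul_of_nonneg_right
    (Real.rpow_le_rpow_of_exponent_le (by norm_num) (neg_le_neg h)) (abs_nonneg _))

/-- PROVED: a depth-`D` reader is a depth-`D'` reader for every `D' ≥ D` (coarse ⇒ blind on smaller balls). [folklore] -/
theorem JointReaderAt.mono {ι : Type} {m : ℕ} {Φ : WindowFields ι m} {win : Window} {D D' : ℝ} (h : D ≤ D')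
    {d₀ : SectorDatum ι} {S : Set (SectorDatum ι)} (hS : JointReaderAt Φ win D d₀ S) :
    JointReaderAt Φ win D' d₀ S := fun d hd => hS d (jointBallAt_anti Φ win h d₀ hd)

/-- **TYPED — A SAME-WINDOW JOINT TWIN AT DEPTH `D`** (the F6 twins; DATA per served window below `D*(a, N)`): some
member of the family `A` lies in the depth-`D` ball of `d₀` at `win` AND is form-negative AT `win` (some sector).
The F6-G3 CEILING is the negation shape `¬ JointTwinAt Φ win D d₀ A` for `D > D*` with `A` replaced by its
first-order box model (CERTIFIED-IN-MODEL, A67) — not a theorem here. [folklore] -/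
def JointTwinAt {ι : Type} {m : ℕ} (Φ : WindowFields ι m) (win : Window) (D : ℝ) (d₀ : SectorDatum ι)
    (A : Set (SectorDatum ι)) : Prop :=
  ∃ d ∈ A, d ∈ jointBallAt Φ win D d₀ ∧ ∃ (i : ι) (v : Fin (win.N + 1) → ℝ), v ⬝ᵥ (d win i *ᵥ v) < 0

/-- PROVED: a twin at depth `D'` is a twin at every depth `D ≤ D'`. [folklore] -/
theorem JointTwinAt.anti {ι : Type} {m : ℕ} {Φ : WindowFields ι m} {win : Window} {D D' : ℝ} (h : D ≤ D')
    {d₀ : SectorDatum ι} {A : Set (SectorDatum ι)} (hT : JointTwinAt Φ win D' d₀ A) : JointTwinAt Φ win D d₀ A := by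
  obtain ⟨d, hdA, hd, i, v, hv⟩ := hT
  exact ⟨d, hdA, jointBallAt_anti Φ win h d₀ hd, i, v, hv⟩

/-- **PROVED — SAME-WINDOW CLOSURE OF DEPTH-`D` JOINT READERS BY A DEPTH-`D` TWIN:** if the family `A ⊆ Dm` has a
joint twin of `d₀` at depth `D` at `win`, no depth-`D` joint reader at `win` separates `d₀` from the detectably
negative members of `Dm` (closure word: closed AT `win`, witness in `A`). [folklore] -/
theorem not_sectorSeparates_of_jointTwinAt {ι : Type} {m : ℕ} {Φ : WindowFields ι m} {win : Window} {D : ℝ}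
    {d₀ : SectorDatum ι} {A Dm S : Set (SectorDatum ι)} (hT : JointTwinAt Φ win D d₀ A) (hA : A ⊆ Dm)
    (hS : JointReaderAt Φ win D d₀ S) : ¬ SectorSeparates S Dm d₀ := by
  rintro ⟨h₀, hsep⟩
  obtain ⟨d, hdA, hd, i, v, hv⟩ := hT
  exact hsep d (hA hdA) ⟨win, i, v, hv⟩ ((hS d hd).2 h₀)

/-- **PROVED — WALL W1 FOR JOINT READERS (every depth, even `D = ∞`):** a joint reader of ANY fields at ONE window,
at ANY depth, cannot separate `ζ`'s multi-sector record from the detectably negative records of the prime dials of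
`ζ`: the heavy dial at a prime beyond the window's reach leaves EVERY sector matrix at `win` identical (so it sits in
every ball) and is form-negative in the even sector higher up. The same-window question (F6-G3) is untouched by
this. [folklore] -/
theorem not_sectorSeparates_of_jointReaderAt {ι : Type} {Θs : ι → ℝ → ℕ → ℕ → ℝ → ℝ} {i₀ : ι}
    (hΘ : Θs i₀ = thetaEven) {m : ℕ} {Φ : WindowFields ι m} {win : Window} {D : ℝ} {S Dm : Set (SectorDatum ι)}
    (hD : ∀ (p : ℕ) (K : ℝ), p.Prime → sectorDatumOf Θs (dial p K zetaWeights) ∈ Dm)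
    (hS : JointReaderAt Φ win D (sectorDatumOf Θs zetaWeights) S) :
    ¬ SectorSeparates S Dm (sectorDatumOf Θs zetaWeights) := by
  rintro ⟨hζ, hsep⟩
  have hS' : SectorDeterminedOn {d : SectorDatum ι | d win = sectorDatumOf Θs zetaWeights win} (below win.a) :=
    fun d d' h => by simp only [Set.mem_setOf_eq, h win (show win.a ≤ win.a from le_rfl)]
  obtain ⟨p, hp, K, -, hmem, v, hv⟩ :=
    exists_heavyDial_mem_sectorNegative_of_determinedOn_below hΘ hS' (by simp only [Set.mem_setOf_eq])
  exact hsep _ (hD p K hp) ⟨logWindow p hp.two_le, i₀, v, hv⟩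
    ((hS _ (mem_jointBallAt_of_eq Φ D hmem)).2 hζ)

/-- even-sector (one-matrix) PUBLISHED FIELDS at a window. [folklore] -/
abbrev EvenWindowFields (m : ℕ) : Type := (win : Window) → Matrix (Fin (win.N + 1)) (Fin (win.N + 1)) ℝ → Fin m → ℝ

/-- the even-sector `τ_rel` ball of depth `D` at `win` around `d₀ : Datum`. [folklore] -/
def evenJointBallAt {m : ℕ} (Φ : EvenWindowFields m) (win : Window) (D : ℝ) (d₀ : Datum) : Set Datum :=
  {d | ∀ i, |Φ win (d win) i - Φ win (d₀ win) i| ≤ (10 : ℝ) ^ (-D) * |Φ win (d₀ win) i|}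

/-- **TYPED — EVEN-SECTOR JOINT READER AT `win` TO DEPTH `D`** (the `Datum`-level form of `JointReaderAt`, for rows
typed on even blocks only). [folklore] -/
def EvenJointReaderAt {m : ℕ} (Φ : EvenWindowFields m) (win : Window) (D : ℝ) (d₀ : Datum) (S : Set Datum) : Prop :=
  ∀ d ∈ evenJointBallAt Φ win D d₀, d ∈ S ↔ d₀ ∈ S

/-- **PROVED — W1 for even-sector joint readers on the arithmetic domain:** no even-sector joint reader at one window
(any fields, any depth) separates `ζ` from the detectably negative data of any domain `⊇ arithDialSpace`. [folklore] -/
theorem not_separates_of_evenJointReaderAt {m : ℕ} {Φ : EvenWindowFields m} {win : Window} {D : ℝ}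
    {S Dm : Set Datum} (hD : arithDialSpace ⊆ Dm) (hS : EvenJointReaderAt Φ win D zetaDatum S) :
    ¬ Separates S Dm zetaDatum := by
  rintro ⟨hζ, hsep⟩
  have hS' : DeterminedOn {d : Datum | d win = zetaDatum win} (below win.a) :=
    fun d d' h => by simp only [Set.mem_setOf_eq, h win (show win.a ≤ win.a from le_rfl)]
  obtain ⟨d, hd, -, hdwin, hneg⟩ := determinedOn_below_meets_arithDialNegativesNe hS' (by simp only [Set.mem_setOf_eq])
  have hball : d ∈ evenJointBallAt Φ win D zetaDatum := fun i => by
    rw [show d win = zetaDatum win from hdwin, sub_self, abs_zero]; positivity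
  exact hsep d (hD hd) hneg ((hS d hball).2 hζ)

/-! ## §2 Band 2 of RULING A73 (F): the multi-sector in-window matching word (TYPED) -/

/-- `S` FACTORS THROUGH the reader `F` on multi-sector records. [folklore] -/
def SectorFactorsThrough {ι ρ : Type} (S : Set (SectorDatum ι)) (F : SectorDatum ι → ρ) : Prop :=
  ∀ d d' : SectorDatum ι, F d = F d' → (d ∈ S ↔ d' ∈ S)

/-- **TYPED — IN-WINDOW DIAL MATCHING AT `win`, MULTI-SECTOR:** a NONEMPTY composite of dials at primes INSIDE `win`
applied to `ζ` reads exactly like `ζ` under `F`, changes the record AT `win`, and is form-negative AT `win` in the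
sector `i₀` (the same-window / served-menu closure word, all parities carried along). [folklore] -/
def InWindowSectorDialMatchingAt {ι ρ : Type} (Θs : ι → ℝ → ℕ → ℕ → ℝ → ℝ) (i₀ : ι) (win : Window)
    (F : SectorDatum ι → ρ) : Prop :=
  ∃ L : List (ℕ × ℝ), L ≠ [] ∧ (∀ pk ∈ L, pk.1.Prime ∧ Real.log pk.1 < 2 * win.a) ∧
    F (sectorDatumOf Θs (multiDial L zetaWeights)) = F (sectorDatumOf Θs zetaWeights) ∧
    sectorDatumOf Θs (multiDial L zetaWeights) win ≠ sectorDatumOf Θs zetaWeights win ∧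
    ∃ v : Fin (win.N + 1) → ℝ, v ⬝ᵥ (sectorDatumOf Θs (multiDial L zetaWeights) win i₀ *ᵥ v) < 0

/-- **PROVED — an in-window matching closes every class factoring through the reader** (multi-sector), on any domain
containing the multi-dial records of `ζ`. [folklore] -/
theorem SectorFactorsThrough.not_sectorSeparates_of_inWindow {ι ρ : Type} {Θs : ι → ℝ → ℕ → ℕ → ℝ → ℝ} {i₀ : ι}
    {win : Window} {F : SectorDatum ι → ρ} {S Dm : Set (SectorDatum ι)} (hS : SectorFactorsThrough S F)
    (hM : InWindowSectorDialMatchingAt Θs i₀ win F)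
    (hD : ∀ L : List (ℕ × ℝ), (∀ pk ∈ L, pk.1.Prime) → sectorDatumOf Θs (multiDial L zetaWeights) ∈ Dm) :
    ¬ SectorSeparates S Dm (sectorDatumOf Θs zetaWeights) := by
  rintro ⟨hζ, hsep⟩
  obtain ⟨L, -, hL, hF, -, v, hv⟩ := hM
  exact hsep _ (hD L fun pk hpk => (hL pk hpk).1) ⟨win, i₀, v, hv⟩ ((hS _ _ hF).2 hζ)

/-- the SAME-WINDOW PAIR READER `(|ε₁^{ev}|, ε₁^{odd})(a, N)` of a two-parity record (sectors `iEv`, `iOdd`). [folklore] -/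
def pairBottomReaderAt {ι : Type} (iEv iOdd : ι) (win : Window) (d : SectorDatum ι) : ℝ × ℝ :=
  (|bottomRayleigh (d win iEv)|, bottomRayleigh (d win iOdd))

/-- **TYPED — BAND 2 OF RULING A73 (F) AT ONE WINDOW (statement only):** the pair reader `(|ε₁^{ev}|, ε₁^{odd})` at
`win` is matched EXACTLY by in-window dials, the matched record being even-sector form-negative AT `win`. NOT proved
here. Its two admissible derivations carry EXPLICIT BINDERS that this cell never asserts: (NK) the served
Newton–Kantorovich datum for `G(t) = (ε₁^{ev}(t) + ε₁^{ev}(ζ), ε₁^{odd}(t) − ε₁^{odd}(ζ))` over two dials `(2, 3)` —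
`h = ‖J⁻¹‖_F · K · ‖J⁻¹G(0)‖ ≤ ½` with `K = 2√2(‖B₂‖² + ‖B₃‖²)/g_min` and the Kantorovich ball inside the gap
region; (PM) Poincaré–Miranda sign conditions of `G₁, G₂` on the four faces of a dial box. Either turns band 2 into a
theorem modulo that binder; band 1 (one dial, `|ε₁^{ev}|` alone) IS a theorem (`PfPersistenceInWindowMirror`). [folklore] -/
def BandTwoAt {ι : Type} (Θs : ι → ℝ → ℕ → ℕ → ℝ → ℝ) (iEv iOdd : ι) (win : Window) : Prop :=
  InWindowSectorDialMatchingAt Θs iEv win (pairBottomReaderAt iEv iOdd win)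

/-- PROVED (bookkeeping): band 2 at `win`, once established, closes every class factoring through the pair reader at
`win` on any domain holding the multi-dial records. [folklore] -/
theorem not_sectorSeparates_of_bandTwoAt {ι : Type} {Θs : ι → ℝ → ℕ → ℕ → ℝ → ℝ} {iEv iOdd : ι} {win : Window}
    (hB : BandTwoAt Θs iEv iOdd win) {S Dm : Set (SectorDatum ι)}
    (hS : SectorFactorsThrough S (pairBottomReaderAt iEv iOdd win))
    (hD : ∀ L : List (ℕ × ℝ), (∀ pk ∈ L, pk.1.Prime) → sectorDatumOf Θs (multiDial L zetaWeights) ∈ Dm) :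
    ¬ SectorSeparates S Dm (sectorDatumOf Θs zetaWeights) :=
  hS.not_sectorSeparates_of_inWindow hB hD

/-! ## §3 The sign-blind ladder reader `S_SB` of record and `𝒞_look(k)` on multi-sector records (carver R12 (a)) -/

/-- a MULTI-SECTOR WINDOW READER: at each window, a set of sector-indexed matrix tuples (the multi-sector form of
`WindowReader`). [folklore] -/
abbrev SectorWindowReader (ι : Type) : Type :=
  (win : Window) → Set (ι → Matrix (Fin (win.N + 1)) (Fin (win.N + 1)) ℝ)

/-- a LADDER FUNCTIONAL: assigns to a window matrix a sequence `k ↦ λ_k` (the eigenvalue ladder of record is one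
instance; kept abstract = any matrix functional). [folklore] -/
abbrev LadderReader : Type := (win : Window) → Matrix (Fin (win.N + 1)) (Fin (win.N + 1)) ℝ → ℕ → ℝ

/-- cand-8's SIGN-BLIND MODULI ORDERING of the two bottom pairs, `|e₁| < |o₁| < |e₂| < |o₂|` (ladders indexed from
`0`). [folklore] -/
def sbOrdered (e o : ℕ → ℝ) : Prop := |e 0| < |o 0| ∧ |o 0| < |e 1| ∧ |e 1| < |o 1|

/-- PROVED: the ordering is SIGN-BLIND — invariant under arbitrary sign flips of the ladder entries. [folklore] -/
theorem sbOrdered_signBlind (e o : ℕ → ℝ) (σ τ : ℕ → SignType) (hσ : ∀ k, σ k ≠ 0) (hτ : ∀ k, τ k ≠ 0) :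
    sbOrdered (fun k => (σ k : ℝ) * e k) (fun k => (τ k : ℝ) * o k) ↔ sbOrdered e o := by
  have h1 : ∀ (s : SignType), s ≠ 0 → ∀ x : ℝ, |(s : ℝ) * x| = |x| := by
    intro s hs x; rcases s with _ | _ | _ <;> simp_all
  simp only [sbOrdered, h1 _ (hσ _), h1 _ (hτ _)]

/-- **TYPED — THE SIGN-BLIND LADDER READER `S_SB` OF RECORD (cand-8 K2-SB) at one window:** the even and odd ladders
(read by `Λ` off the sectors `iEv`, `iOdd`) satisfy the moduli ordering AND a log-concavity condition `LC` (cand-8: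
"log-concavity slack ¼"; kept as a parameter — the exact inequality is the row's). It reads BOTH parities, so it is
a `SectorWindowReader`, not an (even-only) `WindowReader`. [folklore] -/
def signBlindLadderReader {ι : Type} (iEv iOdd : ι) (Λ : LadderReader) (LC : (ℕ → ℝ) → (ℕ → ℝ) → Prop) :
    SectorWindowReader ι := fun win =>
  {M | sbOrdered (Λ win (M iEv)) (Λ win (M iOdd)) ∧ LC (Λ win (M iEv)) (Λ win (M iOdd))}

/-- **`𝒞_look(k)` AT AN ANCHOR on multi-sector records:** the conjunction of the sector reader `S₁` over the `k`
look-ahead windows `win₀, win₀ + h, …` (same `N`) — the multi-sector form of `lookAheadClassAt`. [folklore] -/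
def sectorLookAheadClassAt {ι : Type} (k : ℕ) (win₀ : Window) (h : ℝ) (hh : 0 ≤ h) (S₁ : SectorWindowReader ι) :
    Set (SectorDatum ι) :=
  {d | ∀ j < k, d (win₀.lookAhead h hh j) ∈ S₁ (win₀.lookAhead h hh j)}

/-- **`𝒞_look(k)` ON A FINITE ANCHOR SET**, multi-sector. [folklore] -/
def sectorLookAheadClassOn {ι : Type} (G : Finset Window) (k : ℕ) (h : ℝ) (hh : 0 ≤ h)
    (S₁ : SectorWindowReader ι) : Set (SectorDatum ι) :=
  {d | ∀ win₀ ∈ G, d ∈ sectorLookAheadClassAt k win₀ h hh S₁}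

/-- PROVED: `𝒞_look(k)` at an anchor is decided by its `k` windows (all sectors). [folklore] -/
theorem sectorLookAheadClassAt_finitelyDetermined {ι : Type} (k : ℕ) (win₀ : Window) (h : ℝ) (hh : 0 ≤ h)
    (S₁ : SectorWindowReader ι) : SectorFinitelyDetermined (sectorLookAheadClassAt k win₀ h hh S₁) := by
  classical
  refine ⟨(Finset.range k).image (win₀.lookAhead h hh), fun d d' hdd' => ?_⟩
  simp only [sectorLookAheadClassAt, Set.mem_setOf_eq]
  refine forall₂_congr fun j hj => ?_
  rw [hdd' _ (Finset.mem_image.2 ⟨j, Finset.mem_range.2 hj, rfl⟩)]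

/-- PROVED: `𝒞_look(k)` on a finite anchor set is decided by finitely many windows (all sectors). [folklore] -/
theorem sectorLookAheadClassOn_finitelyDetermined {ι : Type} (G : Finset Window) (k : ℕ) (h : ℝ) (hh : 0 ≤ h)
    (S₁ : SectorWindowReader ι) : SectorFinitelyDetermined (sectorLookAheadClassOn G k h hh S₁) := by
  classical
  refine ⟨G.biUnion fun win₀ => (Finset.range k).image (win₀.lookAhead h hh), fun d d' hdd' => ?_⟩
  simp only [sectorLookAheadClassOn, sectorLookAheadClassAt, Set.mem_setOf_eq]
  refine forall₂_congr fun win₀ hwin₀ => forall₂_congr fun j hj => ?_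
  rw [hdd' _ (Finset.mem_biUnion.2 ⟨win₀, hwin₀, Finset.mem_image.2 ⟨j, Finset.mem_range.2 hj, rfl⟩⟩)]

/-- **PROVED — `𝒞_look(k)` (multi-sector, any sector reader incl. `S_SB`) at an anchor / on a finite grid is
CLOSED-GLOBAL ABOVE GRID by W1:** it cannot separate `ζ`'s record from the detectably negative prime-dial records.
(The in-grid status — inhabited for `a ≤ 0.60`, empty for `a ≥ 0.65` — is cand-8's DATA, not typed.) [folklore] -/
theorem not_sectorSeparates_sectorLookAheadClassOn {ι : Type} {Θs : ι → ℝ → ℕ → ℕ → ℝ → ℝ} {i₀ : ι}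
    (hΘ : Θs i₀ = thetaEven) (G : Finset Window) (k : ℕ) (h : ℝ) (hh : 0 ≤ h) (S₁ : SectorWindowReader ι)
    {Dm : Set (SectorDatum ι)} (hD : ∀ (p : ℕ) (K : ℝ), p.Prime → sectorDatumOf Θs (dial p K zetaWeights) ∈ Dm) :
    ¬ SectorSeparates (sectorLookAheadClassOn G k h hh S₁) Dm (sectorDatumOf Θs zetaWeights) :=
  not_sectorSeparates_of_sectorFinitelyDetermined hΘ hD (sectorLookAheadClassOn_finitelyDetermined G k h hh S₁)

/-! ## §4 Pole-carrying records (lead R10 / cand-7) -/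

/-- **TYPED — THE RECORD WITH POLAR COEFFICIENT `β`:** `win ↦ −(archBlock + primesBlock_w) + β • c cᵀ`
(`c = polarVec win`); `β = 2` is every dial-space record, `β = 0` the pole-free (dh-type) control. [folklore] -/
def polarDatumOf (β : ℝ) (w : Weights) : Datum := fun win =>
  -(archBlock win + primesBlock w win) + β • Matrix.vecMulVec (polarVec win) (polarVec win)

/-- PROVED: every weight-table record carries the pole with coefficient `β = 2`: `datumOf w = polarDatumOf 2 w`
(`evenBlock_eq_poleFree_add_two_smul`). [folklore] -/
theorem datumOf_eq_polarDatumOf_two (w : Weights) : datumOf w = polarDatumOf 2 w := by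
  funext win
  exact evenBlock_eq_poleFree_add_two_smul w win

/-- the records of polar coefficient `β` (all weight tables). [folklore] -/
def polarDialSpace (β : ℝ) : Set Datum := Set.range (polarDatumOf β)

/-- PROVED: the dial space IS the `β = 2` family. [folklore] -/
theorem dialSpace_eq_polarDialSpace_two : dialSpace = polarDialSpace 2 := by
  ext d
  simp only [dialSpace, polarDialSpace, Set.mem_range, datumOf_eq_polarDatumOf_two]

/-- **TYPED — POLE-CARRYING record:** representable with a POSITIVE polar coefficient. (Typing G1.08 / G1.21c "on
objects with a pole" = restricting their domain to this class.) [folklore] -/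
def PoleCarrying (d : Datum) : Prop := ∃ β : ℝ, 0 < β ∧ d ∈ polarDialSpace β

/-- PROVED: every dial-space record — in particular every member of the tally domain `arithDialSpace` — is
pole-carrying (`β = 2`); restricting G1.08 / G1.21c to pole-carrying objects does not shrink the tally domain. [folklore] -/
theorem poleCarrying_of_mem_dialSpace {d : Datum} (hd : d ∈ dialSpace) : PoleCarrying d :=
  ⟨2, two_pos, by rwa [← dialSpace_eq_polarDialSpace_two]⟩

/-- PROVED: the arithmetic dial space is pole-carrying. [folklore] -/
theorem poleCarrying_of_mem_arithDialSpace {d : Datum} (hd : d ∈ arithDialSpace) : PoleCarrying d :=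
  poleCarrying_of_mem_dialSpace (arithDialSpace_subset_dialSpace hd)

/-- the POLE-FREE (dh-type, `q_polar = 0`) record of a weight table: the DEGENERATE member `β = 0` of the polar
family, on which pole-based criteria (`PFLow` / `PFUp` / `PFMid`, `0 ≤ β`) degenerate (cand-7: `K_pf ↦ [ε₂ ≥ 0]`). [folklore] -/
def poleFreeDatumOf (w : Weights) : Datum := polarDatumOf 0 w

/-- PROVED: the pole-free record is `−(archBlock + primesBlock_w)` on the nose. [folklore] -/
theorem poleFreeDatumOf_apply (w : Weights) (win : Window) :
    poleFreeDatumOf w win = -(archBlock win + primesBlock w win) := by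
  simp [poleFreeDatumOf, polarDatumOf]

end Summit.RiemannHypothesis.RiemannHypothesis.Theorems.PfPersistence

end
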